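import Summits.BirchSwinnertonDyer.BirchSwinnertonDyer.Theorems.ClassRecordThreeEulerHalvesAtThreeCartanCoverCocompact
import Summits.BirchSwinnertonDyer.BirchSwinnertonDyer.Theorems.ClassRecordThreeEulerHalvesAtThreeCartanCoverHeckePeriods
import Mathlib.Analysis.Complex.Cardinality
import HarnessLib

/-!
# Crux NUM `CartanOnePlaceDegreeLawAtThree` (item 24801), line `lattice` — the print fact (ISO) `cartanParametrizationData_deg_of_periods_mul` DISCHARGED for `D > 1`

Seat `bsd-stepL-tam3-p1` g27 (LEAD of crux 24801; `--supports stmt-BirchSwinnertonDyer-24801 --as helper`). For a Cartan datum `X` of level `(D, M; C)` with `D > 1` (compact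
quotient), `Q : CartanParametrizationData X W` and `n ≥ 2` with every `Γ`-period of `Q.form` in `n·Λ_L`: the datum `Q' = (L, uniformize, n⁻¹·form, τ₀, d')` exists and
`n²·d' = Q.deg` (`deg_of_periods_mul_of_one_lt`). PROOF: `n⁻¹·form ≠ 0` has periods in `Λ_L`, hence a degree `d'` (tree `MapDegree.cartanGamma_finite_badClasses_of_one_lt`, p734907 + the cocompactness file:
Farkas–Kra on the cocompact group `X.Gamma`); the fibre of `Γτ ↦ ∫form = n·∫(n⁻¹form)` over a class `w₀ + Λ` is the DISJOINT union over the `n²` classes `(w₀ + aω₁ + bω₂)∕n + Λ`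
(`0 ≤ a, b < n`; distinct by `PeriodPair.mul_ω₁_add_mul_ω₂_mem_lattice`) of the fibres of `n⁻¹form`; at a base value `w₀` off a countable exceptional set (ℂ is uncountable) all
`n² + 1` counts are generic, so `Q.deg = n²·d'`. So the VARIANT-N cite conjunct (ISO) of `Lines/lattice` is PRINT for `D = 1` only (`exists_deg` for the non-compact modular
Cartan curve = Farkas–Kra after compactification at the cusps; not ported). Nothing about NUM or any curve is proved; BSD is proved for no curve. [cite: FarkasKra1992, Prop. I.1.6]
[cite: SilvermanAEC2009, III.6.2 (d)]
-/

set_option linter.dupNamespace false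
set_option autoImplicit false

noncomputable section

open scoped MatrixGroups ModularForm Topology Pointwise
open UpperHalfPlane Filter Set Function

namespace Summit.BirchSwinnertonDyer.BirchSwinnertonDyer.Theorems.CartanCover.MapDegree

open Literature.NumberTheory.Automorphic

variable {D M : ℕ} {C : Finset ℕ} {X : CartanLevelCurveData D M C} {W : WeierstrassCurve ℚ}
  (Q : CartanParametrizationData X W)

/-! ## §1 The uniformisation identifies `ℂ∕Λ_L` with `W(ℂ)`; `form ≠ 0` -/

/-- `x − y ∈ Λ_L ↔ uniformize x = uniformize y` (the kernel is the lattice; Cartan-level datum). -/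
theorem cartan_sub_mem_lattice_iff (x y : ℂ) : x - y ∈ Q.L.lattice ↔ Q.uniformize x = Q.uniformize y := by
  rw [← sub_eq_zero, ← map_sub, ← AddMonoidHom.mem_ker]
  have h := Set.ext_iff.mp Q.ker_uniformize (x - y)
  exact h.symm

/-- `uniformize x = uniformize y ↔ x − y ∈ Λ_L`. -/
private theorem uniformize_eq_iff (x y : ℂ) : Q.uniformize x = Q.uniformize y ↔ x - y ∈ Q.L.lattice := (cartan_sub_mem_lattice_iff Q x y).symm

/-- **`Q.form ≠ 0`** for a Cartan-level parametrisation datum (else every point `≠ uniformize 0` has an empty fibre, `W(ℂ)` would be finite and `ℂ` countable). [folklore] -/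
theorem cartan_form_ne_zero : Q.form ≠ 0 := by
  classical
  intro h0'
  have h0 : (⇑Q.form : ℍ → ℂ) = 0 := by rw [h0']; rfl
  have hΨ : ∀ τ : ℍ, segmentIntegral Q.form Q.basePoint τ = 0 := fun τ => by simp [segmentIntegral, h0]
  have hsub : (Set.univ : Set (W.baseChange ℂ).toAffine.Point) ⊆
      {P | Nat.card {y : MulAction.orbitRel.Quotient X.Gamma ℍ // ∃ τ : ℍ,
        (Quotient.mk _ τ : MulAction.orbitRel.Quotient X.Gamma ℍ) = y ∧
          Q.uniformize (segmentIntegral Q.form Q.basePoint τ) = P} ≠ Q.deg} ∪ {0} := by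
    intro P _
    by_cases hP : P = 0
    · exact Or.inr hP
    · refine Or.inl ?_
      simp only [mem_setOf_eq]
      haveI : IsEmpty {y : MulAction.orbitRel.Quotient X.Gamma ℍ // ∃ τ : ℍ,
          (Quotient.mk _ τ : MulAction.orbitRel.Quotient X.Gamma ℍ) = y ∧
            Q.uniformize (segmentIntegral Q.form Q.basePoint τ) = P} := by
        refine ⟨fun y => ?_⟩
        obtain ⟨τ, -, hτ⟩ := y.2
        apply hP
        rw [← hτ, hΨ, map_zero]
      rw [Nat.card_of_isEmpty]
      exact Q.deg_pos.ne
  have hfin : (Set.univ : Set (W.baseChange ℂ).toAffine.Point).Finite := (Q.deg_spec.union (Set.finite_singleton 0)).subset hsub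
  -- `ℂ` = union of the (countable) cosets over the finitely many points
  haveI : Countable Q.L.lattice := Countable.of_equiv _ Q.L.latticeEquivProd.toEquiv.symm
  choose wP hwP using fun P => Q.uniformize_surjective P
  have hcount : (Set.univ : Set ℂ).Countable := by
    refine Set.Countable.mono (fun x _ => ?_) (hfin.countable.biUnion fun P _ => Set.countable_range (fun l : Q.L.lattice => wP P + (l : ℂ)))
    have hl : x - wP (Q.uniformize x) ∈ Q.L.lattice := by rw [← uniformize_eq_iff Q, hwP]
    exact mem_iUnion₂.mpr ⟨Q.uniformize x, mem_univ _, ⟨x - wP _, hl⟩, add_sub_cancel _ _⟩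
  exact not_countable_complex hcount

/-! ## §2 (ISO) for `D > 1` -/

/-- **(ISO) for `D > 1`**: if every `Γ`-period of `Q.form` is `n` times a lattice element (`n ≥ 2`), there is a datum `Q'` of the same curve on `X` (form `n⁻¹·Q.form`, same lattice,
uniformisation and base point) with `n²·Q'.deg = Q.deg`. [cite: FarkasKra1992, Prop. I.1.6] [cite: SilvermanAEC2009, III.6.2 (d)] -/
theorem deg_of_periods_mul_of_one_lt (hD : 1 < D) (n : ℕ) (hn : 2 ≤ n)
    (hper : ∀ γ ∈ X.Gamma, ∀ z : ℍ, ∃ x ∈ Q.L.lattice, segmentIntegral Q.form z (γ • z) = (n : ℂ) * x) :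
    ∃ Q' : CartanParametrizationData X W, n ^ 2 * Q'.deg = Q.deg := by
  classical
  have hn0 : (n : ℂ) ≠ 0 := by exact_mod_cast (show n ≠ 0 by omega)
  -- the form `n⁻¹ · Q.form`, its primitive and periods
  set F' : CuspForm X.Gamma 2 := (n : ℂ)⁻¹ • Q.form with hF'def
  have hF' : ∀ τ, F' τ = (n : ℂ)⁻¹ * Q.form τ := fun τ => by rw [hF'def, CuspForm.IsGLPos.smul_apply, smul_eq_mul]
  have hseg : ∀ z w : ℍ, segmentIntegral F' z w = (n : ℂ)⁻¹ * segmentIntegral Q.form z w := by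
    intro z w
    obtain ⟨H, hH⟩ := exists_hasDerivAt_primitive Q.form
    have hH' : ∀ u : ℂ, 0 < u.im → HasDerivAt (fun v => (n : ℂ)⁻¹ * H v) (F' (ofComplex u)) u := by
      intro u hu; rw [hF']; exact (hH u hu).const_mul _
    rw [segmentIntegral_eq_sub F' hH' z w, segmentIntegral_eq_sub Q.form hH z w]; ring
  have hseg' : ∀ z w : ℍ, segmentIntegral Q.form z w = (n : ℂ) * segmentIntegral F' z w := by
    intro z w; rw [hseg, ← mul_assoc, mul_inv_cancel₀ hn0, one_mul]
  have hper' : HasPeriodsIn X.Gamma (⇑F') (Q.L.lattice : Set ℂ) := by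
    intro γ hγ z
    obtain ⟨x, hx, hxe⟩ := hper γ hγ z
    rw [hseg, hxe, ← mul_assoc, inv_mul_cancel₀ hn0, one_mul]
    exact hx
  have hne' : (⇑F' : ℍ → ℂ) ≠ 0 := by
    intro h0
    apply cartan_form_ne_zero Q
    apply DFunLike.coe_injective
    rw [CuspForm.coe_zero]
    funext τ
    have := congr_fun h0 τ
    rw [hF'] at this
    simpa [hn0] using this
  -- the degree of `F'`
  set τ₀ := Q.basePoint with hτ₀
  obtain ⟨d', hbad', hd'pos⟩ := cartanGamma_finite_badClasses_of_one_lt X hD F' hne' Q.L hper' τ₀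
  set Λ' : AddSubgroup ℂ := Q.L.lattice.toAddSubgroup with hΛ'
  set Ψ' : ℍ → ℂ := segmentIntegral F' τ₀ with hΨ'
  -- fibre sets of `Ψ'` over a value `w`
  set S : ℂ → Set (MulAction.orbitRel.Quotient X.Gamma ℍ) :=
    fun w => {y | ∃ τ : ℍ, (Quotient.mk _ τ : MulAction.orbitRel.Quotient X.Gamma ℍ) = y ∧ Ψ' τ - w ∈ Q.L.lattice} with hSdef
  -- the count over a class equals the count of `S`
  have hcardS : ∀ w : ℂ, Nat.card {y : MulAction.orbitRel.Quotient X.Gamma ℍ // ∃ τ : ℍ,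
      (Quotient.mk _ τ : MulAction.orbitRel.Quotient X.Gamma ℍ) = y ∧ ((Ψ' τ : ℂ) : ℂ ⧸ Λ') = (w : ℂ ⧸ Λ')} = Nat.card (S w) := by
    intro w
    refine Nat.card_congr (Equiv.subtypeEquivRight fun y => ?_)
    simp only [hSdef, mem_setOf_eq, QuotientAddGroup.eq_iff_sub_mem, hΛ', Submodule.mem_toAddSubgroup]
  have hgoodS : ∀ w : ℂ, ((w : ℂ) : ℂ ⧸ Λ') ∉ {c : ℂ ⧸ Λ' | Nat.card {y : MulAction.orbitRel.Quotient X.Gamma ℍ // ∃ τ : ℍ,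
      (Quotient.mk _ τ : MulAction.orbitRel.Quotient X.Gamma ℍ) = y ∧ ((segmentIntegral F' τ₀ τ : ℂ) : ℂ ⧸ Λ') = c} ≠ d'} →
      Nat.card (S w) = d' := by
    intro w hw
    rw [← hcardS]
    by_contra h
    exact hw h
  -- the datum `Q'`
  refine ⟨{ L := Q.L
            isNeronLattice := Q.isNeronLattice
            uniformize := Q.uniformize
            ker_uniformize := Q.ker_uniformize
            uniformize_surjective := Q.uniformize_surjective
            uniformize_spec := Q.uniformize_spec
            form := F'
            basePoint := τ₀
            period_mem := hper'
            hecke_eq := ?_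
            deg := d'
            deg_pos := hd'pos
            deg_spec := ?_ }, ?_⟩
  · -- Hecke: `T_ℓ (n⁻¹ f) = n⁻¹ T_ℓ f = a_ℓ · n⁻¹ f`
    intro ℓ hℓ hnd
    have hQ := Q.hecke_eq ℓ hℓ hnd
    have hcoe : (⇑F' : ℍ → ℂ) = (n : ℂ)⁻¹ • (⇑Q.form : ℍ → ℂ) := by funext τ; rw [hF', Pi.smul_apply, smul_eq_mul]
    funext τ
    rw [hcoe]
    simp only [CartanLevelCurveData.heckeFun]
    have hsl : ∀ q : Quotient (X.heckeSetoid ℓ), (((n : ℂ)⁻¹ • (⇑Q.form : ℍ → ℂ)) ∣[(2 : ℤ)] ((q.out : X.heckeSet ℓ) : GL (Fin 2) ℝ)) τ =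
        (n : ℂ)⁻¹ * ((⇑Q.form : ℍ → ℂ) ∣[(2 : ℤ)] ((q.out : X.heckeSet ℓ) : GL (Fin 2) ℝ)) τ := by
      intro q
      rw [smul_slash_of_det_pos (HeckePeriod.det_pos_of_mem_heckeSet X (q.out : X.heckeSet ℓ).2), Pi.smul_apply, smul_eq_mul]
    simp_rw [hsl]
    rw [← mul_finsum, Pi.smul_apply, smul_eq_mul]
    have := congr_fun hQ τ
    simp only [CartanLevelCurveData.heckeFun] at this
    rw [this]; ring
  · -- `deg_spec` of `Q'`: bad points are images of bad classes
    refine (hbad'.image (fun c : ℂ ⧸ Λ' => Q.uniformize c.out)).subset ?_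
    intro P hP
    obtain ⟨w, rfl⟩ := Q.uniformize_surjective P
    refine ⟨(w : ℂ ⧸ Λ'), ?_, ?_⟩
    · simp only [mem_setOf_eq] at hP ⊢
      rw [hcardS w]
      intro h; apply hP
      rw [← h]
      refine Nat.card_congr (Equiv.subtypeEquivRight fun y => ?_)
      constructor
      · rintro ⟨τ, h1, h2⟩
        exact ⟨τ, h1, (uniformize_eq_iff Q _ _).mp h2⟩
      · rintro ⟨τ, h1, h2⟩
        exact ⟨τ, h1, (uniformize_eq_iff Q _ _).mpr h2⟩
    · rw [uniformize_eq_iff Q, ← Submodule.mem_toAddSubgroup, ← hΛ', ← QuotientAddGroup.eq_iff_sub_mem, QuotientAddGroup.out_eq']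
  · -- the degree relation `n² d' = Q.deg`
    -- (a) decomposition of the `Ψ = n Ψ'`-fibre over `w₀` into the `Ψ'`-fibres over `(w₀ + a ω₁ + b ω₂)/n`
    set wab : ℂ → Fin n × Fin n → ℂ := fun w₀ ab => (w₀ + ((ab.1 : ℕ) : ℂ) * Q.L.ω₁ + ((ab.2 : ℕ) : ℂ) * Q.L.ω₂) / (n : ℂ) with hwab
    have hT : ∀ w₀ : ℂ, {y : MulAction.orbitRel.Quotient X.Gamma ℍ | ∃ τ : ℍ, (Quotient.mk _ τ : MulAction.orbitRel.Quotient X.Gamma ℍ) = y ∧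
        segmentIntegral Q.form τ₀ τ - w₀ ∈ Q.L.lattice} = ⋃ ab : Fin n × Fin n, S (wab w₀ ab) := by
      intro w₀
      ext y
      simp only [mem_setOf_eq, mem_iUnion, hSdef]
      constructor
      · rintro ⟨τ, rfl, hτ⟩
        obtain ⟨p, q, hpq⟩ := PeriodPair.mem_lattice.mp hτ
        have hnpos : 0 < (n : ℤ) := by exact_mod_cast (show 0 < n by omega)
        refine ⟨(⟨(p % (n : ℤ)).toNat, ?_⟩, ⟨(q % (n : ℤ)).toNat, ?_⟩), τ, rfl, ?_⟩
        · have h1 := Int.emod_lt_of_pos p hnpos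
          have h2 := Int.emod_nonneg p hnpos.ne'
          omega
        · have h1 := Int.emod_lt_of_pos q hnpos
          have h2 := Int.emod_nonneg q hnpos.ne'
          omega
        · rw [PeriodPair.mem_lattice]
          refine ⟨p / (n : ℤ), q / (n : ℤ), ?_⟩
          have hp : (((p % (n : ℤ)).toNat : ℕ) : ℂ) = ((p % (n : ℤ) : ℤ) : ℂ) := by
            rw [← Int.cast_natCast, Int.toNat_of_nonneg (Int.emod_nonneg p hnpos.ne')]
          have hq : (((q % (n : ℤ)).toNat : ℕ) : ℂ) = ((q % (n : ℤ) : ℤ) : ℂ) := by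
            rw [← Int.cast_natCast, Int.toNat_of_nonneg (Int.emod_nonneg q hnpos.ne')]
          have ep : ((p : ℤ) : ℂ) - ((p % (n : ℤ) : ℤ) : ℂ) = (n : ℂ) * ((p / (n : ℤ) : ℤ) : ℂ) := by
            have := Int.emod_add_mul_ediv p (n : ℤ)
            have h' : ((p : ℤ) : ℂ) = ((p % (n : ℤ) : ℤ) : ℂ) + ((n : ℤ) : ℂ) * ((p / (n : ℤ) : ℤ) : ℂ) := by
              rw [← Int.cast_mul, ← Int.cast_add, this]
            rw [h']; push_cast; ring
          have eq' : ((q : ℤ) : ℂ) - ((q % (n : ℤ) : ℤ) : ℂ) = (n : ℂ) * ((q / (n : ℤ) : ℤ) : ℂ) := by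
            have := Int.emod_add_mul_ediv q (n : ℤ)
            have h' : ((q : ℤ) : ℂ) = ((q % (n : ℤ) : ℤ) : ℂ) + ((n : ℤ) : ℂ) * ((q / (n : ℤ) : ℤ) : ℂ) := by
              rw [← Int.cast_mul, ← Int.cast_add, this]
            rw [h']; push_cast; ring
          have hgoal : (n : ℂ) * (Ψ' τ - wab w₀ (⟨(p % (n : ℤ)).toNat, by
              have h1 := Int.emod_lt_of_pos p hnpos; have h2 := Int.emod_nonneg p hnpos.ne'; omega⟩,
              ⟨(q % (n : ℤ)).toNat, by have h1 := Int.emod_lt_of_pos q hnpos; have h2 := Int.emod_nonneg q hnpos.ne'; omega⟩)) =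
              segmentIntegral Q.form τ₀ τ - w₀ - ((p % (n : ℤ) : ℤ) : ℂ) * Q.L.ω₁ - ((q % (n : ℤ) : ℤ) : ℂ) * Q.L.ω₂ := by
            simp only [hwab, hp, hq]
            rw [hΨ', hseg]
            field_simp
            ring
          apply mul_left_cancel₀ hn0
          rw [hgoal]
          linear_combination hpq - Q.L.ω₁ * ep - Q.L.ω₂ * eq'
      · rintro ⟨ab, τ, rfl, hτ⟩
        refine ⟨τ, rfl, ?_⟩
        have e : segmentIntegral Q.form τ₀ τ - w₀ = (n : ℂ) * (Ψ' τ - wab w₀ ab) + (((ab.1 : ℕ) : ℤ) : ℂ) * Q.L.ω₁ + (((ab.2 : ℕ) : ℤ) : ℂ) * Q.L.ω₂ := by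
          rw [hΨ', hseg, hwab]
          field_simp
          push_cast
          ring
        rw [e]
        refine Q.L.lattice.add_mem (Q.L.lattice.add_mem ?_ ?_) ?_
        · have : (n : ℂ) * (Ψ' τ - wab w₀ ab) = (n : ℤ) • (Ψ' τ - wab w₀ ab) := by rw [zsmul_eq_mul]; push_cast; ring
          rw [this]; exact Q.L.lattice.smul_mem _ hτ
        · rw [← zsmul_eq_mul]; exact Q.L.lattice.smul_mem _ Q.L.ω₁_mem_lattice
        · rw [← zsmul_eq_mul]; exact Q.L.lattice.smul_mem _ Q.L.ω₂_mem_lattice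
    -- (b) disjointness
    have hdisj : ∀ w₀ : ℂ, ∀ ab ab' : Fin n × Fin n, ab ≠ ab' → Disjoint (S (wab w₀ ab)) (S (wab w₀ ab')) := by
      intro w₀ ab ab' hne
      rw [Set.disjoint_left]
      rintro y ⟨τ, rfl, hτ⟩ ⟨τ', hττ', hτ'⟩
      apply hne
      -- `τ'` and `τ` are in the same orbit: their `Ψ'`-values differ by a lattice element
      have horb : Ψ' τ' - Ψ' τ ∈ Q.L.lattice := by
        obtain ⟨γ, rfl⟩ := Quotient.exact hττ'
        rw [hΨ', segmentIntegral_sub_segmentIntegral F' τ₀ τ (γ • τ)]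
        exact hper' γ γ.2 τ
      have hdiff : wab w₀ ab - wab w₀ ab' ∈ Q.L.lattice := by
        have e : wab w₀ ab - wab w₀ ab' = (Ψ' τ' - wab w₀ ab') - (Ψ' τ - wab w₀ ab) - (Ψ' τ' - Ψ' τ) := by ring
        rw [e]; exact Q.L.lattice.sub_mem (Q.L.lattice.sub_mem hτ' hτ) horb
      have e2 : wab w₀ ab - wab w₀ ab' = ((((ab.1 : ℕ) : ℚ) - ((ab'.1 : ℕ) : ℚ)) / n : ℚ) * Q.L.ω₁ + ((((ab.2 : ℕ) : ℚ) - ((ab'.2 : ℕ) : ℚ)) / n : ℚ) * Q.L.ω₂ := by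
        simp only [hwab]; push_cast; field_simp; ring
      rw [e2, PeriodPair.mul_ω₁_add_mul_ω₂_mem_lattice] at hdiff
      obtain ⟨h1, h2⟩ := hdiff
      have key : ∀ (a a' : Fin n), ((((a : ℕ) : ℚ) - ((a' : ℕ) : ℚ)) / n : ℚ).den = 1 → a = a' := by
        intro a a' h
        have hnq : (n : ℚ) ≠ 0 := by exact_mod_cast (show n ≠ 0 by omega)
        set r : ℚ := (((a : ℕ) : ℚ) - ((a' : ℕ) : ℚ)) / n with hr
        have hnum : (r.num : ℚ) = r := (Rat.den_eq_one_iff r).mp h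
        have hq' : ((a : ℕ) : ℚ) - ((a' : ℕ) : ℚ) = (r.num : ℚ) * (n : ℚ) := by
          rw [hnum, hr, div_mul_cancel₀ _ hnq]
        have hk' : ((a : ℕ) : ℤ) - ((a' : ℕ) : ℤ) = r.num * (n : ℤ) := by exact_mod_cast hq'
        have ha := a.2; have ha' := a'.2
        have hk0 : r.num = 0 := by
          by_contra hk0
          have h1 : (n : ℤ) ≤ |((a : ℕ) : ℤ) - ((a' : ℕ) : ℤ)| := by
            rw [hk', abs_mul, Nat.abs_cast]
            exact le_mul_of_one_le_left (by positivity) (Int.one_le_abs hk0)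
          have h2 : |((a : ℕ) : ℤ) - ((a' : ℕ) : ℤ)| < n := by rw [abs_sub_lt_iff]; constructor <;> omega
          omega
        rw [hk0, zero_mul, sub_eq_zero] at hk'
        exact Fin.ext (by exact_mod_cast hk')
      exact Prod.ext (key _ _ h1) (key _ _ h2)
    -- (c) a generic base value `w₀`
    have hbadQ := Q.deg_spec
    haveI : Countable Q.L.lattice := Countable.of_equiv _ Q.L.latticeEquivProd.toEquiv.symm
    set badC : Set (ℂ ⧸ Λ') := {c : ℂ ⧸ Λ' | Nat.card {y : MulAction.orbitRel.Quotient X.Gamma ℍ // ∃ τ : ℍ,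
      (Quotient.mk _ τ : MulAction.orbitRel.Quotient X.Gamma ℍ) = y ∧ ((segmentIntegral F' τ₀ τ : ℂ) : ℂ ⧸ Λ') = c} ≠ d'} with hbadC
    set E₁ : Set ℂ := ⋃ ab : Fin n × Fin n, {w₀ | ((wab w₀ ab : ℂ) : ℂ ⧸ Λ') ∈ badC} with hE₁
    set E₂ : Set ℂ := Q.uniformize ⁻¹' {P | Nat.card {y : MulAction.orbitRel.Quotient X.Gamma ℍ // ∃ τ : ℍ,
      (Quotient.mk _ τ : MulAction.orbitRel.Quotient X.Gamma ℍ) = y ∧ Q.uniformize (segmentIntegral Q.form Q.basePoint τ) = P} ≠ Q.deg} with hE₂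
    have hE₁c : E₁.Countable := by
      refine Set.countable_iUnion fun ab => ?_
      -- `{w₀ | mk (wab w₀ ab) ∈ badC}` ⊆ ⋃_{c ∈ badC} range (l ↦ n (c.out + l) − a ω₁ − b ω₂)
      refine Set.Countable.mono (fun w₀ hw₀ => ?_)
        (hbad'.countable.biUnion fun c _ => Set.countable_range (fun l : Q.L.lattice =>
          (n : ℂ) * ((c : ℂ ⧸ Λ').out + (l : ℂ)) - ((ab.1 : ℕ) : ℂ) * Q.L.ω₁ - ((ab.2 : ℕ) : ℂ) * Q.L.ω₂))
      have hmem : ((wab w₀ ab : ℂ) : ℂ ⧸ Λ') ∈ badC := hw₀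
      have hl : wab w₀ ab - ((wab w₀ ab : ℂ) : ℂ ⧸ Λ').out ∈ Q.L.lattice := by
        rw [← Submodule.mem_toAddSubgroup, ← hΛ', ← QuotientAddGroup.eq_iff_sub_mem, QuotientAddGroup.out_eq']
      refine mem_iUnion₂.mpr ⟨_, hmem, ⟨wab w₀ ab - ((wab w₀ ab : ℂ) : ℂ ⧸ Λ').out, hl⟩, ?_⟩
      simp only [hwab]
      field_simp
      ring
    have hE₂c : E₂.Countable := by
      choose wP hwP using fun P => Q.uniformize_surjective P
      refine Set.Countable.mono (fun x hx => ?_) (hbadQ.countable.biUnion fun P _ => Set.countable_range (fun l : Q.L.lattice => wP P + (l : ℂ)))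
      have hl : x - wP (Q.uniformize x) ∈ Q.L.lattice := by rw [← uniformize_eq_iff Q, hwP]
      exact mem_iUnion₂.mpr ⟨Q.uniformize x, hx, ⟨x - wP _, hl⟩, add_sub_cancel _ _⟩
    obtain ⟨w₀, hw₀⟩ : (E₁ ∪ E₂)ᶜ.Nonempty := by
      by_contra h
      rw [Set.not_nonempty_iff_eq_empty, Set.compl_empty_iff] at h
      exact not_countable_complex (by rw [← h]; exact hE₁c.union hE₂c)
    rw [Set.mem_compl_iff, Set.mem_union, not_or] at hw₀
    obtain ⟨hw₁, hw₂⟩ := hw₀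
    -- (d) the counts at `w₀`
    have hSab : ∀ ab : Fin n × Fin n, Nat.card (S (wab w₀ ab)) = d' := by
      intro ab
      apply hgoodS
      intro h
      exact hw₁ (mem_iUnion.mpr ⟨ab, h⟩)
    have hfinab : ∀ ab : Fin n × Fin n, (S (wab w₀ ab)).Finite := fun ab =>
      Nat.finite_of_card_ne_zero (by rw [hSab ab]; exact hd'pos.ne')
    have hQdeg : Nat.card {y : MulAction.orbitRel.Quotient X.Gamma ℍ // ∃ τ : ℍ,
        (Quotient.mk _ τ : MulAction.orbitRel.Quotient X.Gamma ℍ) = y ∧ Q.uniformize (segmentIntegral Q.form Q.basePoint τ) = Q.uniformize w₀} = Q.deg := by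
      by_contra h
      exact hw₂ h
    have hTcard : Nat.card {y : MulAction.orbitRel.Quotient X.Gamma ℍ // ∃ τ : ℍ,
        (Quotient.mk _ τ : MulAction.orbitRel.Quotient X.Gamma ℍ) = y ∧ Q.uniformize (segmentIntegral Q.form Q.basePoint τ) = Q.uniformize w₀} =
        Nat.card (⋃ ab : Fin n × Fin n, S (wab w₀ ab)) := by
      rw [← hT w₀]
      refine Nat.card_congr (Equiv.subtypeEquivRight fun y => ?_)
      constructor
      · rintro ⟨τ, h1, h2⟩
        exact ⟨τ, h1, (uniformize_eq_iff Q _ _).mp h2⟩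
      · rintro ⟨τ, h1, h2⟩
        exact ⟨τ, h1, (uniformize_eq_iff Q _ _).mpr h2⟩
    have hUcard : Nat.card (⋃ ab : Fin n × Fin n, S (wab w₀ ab)) = ∑ ab : Fin n × Fin n, Nat.card (S (wab w₀ ab)) := by
      rw [Nat.card_coe_set_eq, Set.ncard_iUnion_of_finite hfinab (fun ab ab' hne => hdisj w₀ ab ab' hne), finsum_eq_sum_of_fintype]
      simp only [Nat.card_coe_set_eq]
    rw [hTcard, hUcard] at hQdeg
    simp only [hSab, Finset.sum_const, Finset.card_univ, Fintype.card_prod, Fintype.card_fin, smul_eq_mul] at hQdeg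
    rw [← hQdeg]; ring

/-- **(ISO) `cartanParametrizationData_deg_of_periods_mul` holds at every level with `D > 1`** (the print fact of `Lines/lattice`'s cite stub, discharged on compact quotients).
[cite: FarkasKra1992, Prop. I.1.6] -/
theorem cartanParametrizationData_deg_of_periods_mul_of_one_lt {D M : ℕ} {C : Finset ℕ} (hD : 1 < D) (X : CartanLevelCurveData D M C)
    (W : WeierstrassCurve ℚ) [W.IsElliptic] (Q : CartanParametrizationData X W) (n : ℕ) (hn : 2 ≤ n)
    (hper : ∀ γ ∈ X.Gamma, ∀ z : ℍ, ∃ x ∈ Q.L.lattice, segmentIntegral Q.form z (γ • z) = (n : ℂ) * x) :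
    ∃ Q' : CartanParametrizationData X W, n ^ 2 * Q'.deg = Q.deg :=
  deg_of_periods_mul_of_one_lt Q hD n hn hper

end Summit.BirchSwinnertonDyer.BirchSwinnertonDyer.Theorems.CartanCover.MapDegree

end
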